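import Summits.Ventures.HSemireg.WedgeWeilPurityGeneric

/-!
# Venture HSemireg — W-PURITY: the exceptional locus — generic value iff ab ∉ Λ(q), |Λ(q)| ≤ ρ

HONEST FRAMING. Part of the Lean index of the computation cell `pub-hsemireg` (second enclosure wave, cut by seat p6 in the
conventions of seat p3's ENCLOSURE-PLAN-p3.md / build.py from th-7's kernel assets).  Finite-dimensional exterior algebra over a field ONLY:
no variety, no cohomology theory, no semiregularity map is constructed here; nothing here says that HC / HC_CM / HC_AV holds;
no Literature fact is declared or used.  The geometric DICTIONARY (why these ranks are the `HT`-side box ranks of the cell's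
STRUCTURE.md §1 / theory/FORMULA-N.md) lives in theory/FORMULA-N-th7.md PART B §A.3 / §N and is NOT asserted in Lean.

th-7's PART S4 — THE EXCEPTIONAL LOCUS `{ab ∈ Λ(q)}` (theory/th7/WPurityStructure.lean v4 4939660b94ce7cee, PART S4 (= WPurityStructure.PartS4.lean 9d66d4cfe7a7147c; th-7 g7, 02:56Z 2026-08-23; ×2 th-2 g23 02:57Z farm rc 0 + axioms standard + statement read; th-7's negative control «2C(2n,n) → 2C(2n,n)+1» rc 1), the block after PART S3's `end Generic`),
VERBATIM up to the namespace (`HSemiregWeil` ↦ `Summit.Ventures.HSemireg.Wedge.Weil`): Weil type `(n,n)`, `m = n ≥ 1`, EVERY `q` (any `ρ = rank H_n(q)`), EVERY field.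
`schurOp_eq_one` (the Schur operator `ψ₋ψ₊ − ab·id` depends on the product `ab` only), `rank_eq_iff_ker_bot` (the rank equation of `weilPurity_schur` holds iff
`Hom(Gm) n ⊓ ker(ψ₋ψ₊ − ab) = ⊥`), and **`weilPurity_locus (hn : 1 ≤ n) (q)`**: `∃ Λ : Finset K, 0 ∉ Λ ∧ Λ.card ≤ (hankel1 K (n+n) n q).rank ∧ ∀ a b, a ≠ 0 → b ≠ 0 →
(finrank range(wedge K (n+n) n (vW K (n+n) n q a b)) + 2ρ = C(2n,n)·ρ + (C(2n,n) + C(2n,n)) ↔ a * b ∉ Λ)` — there is a finite set `Λ(q) ⊆ K ∖ {0}` of AT MOST `ρ`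
«exceptional products», depending on `q` ONLY (the non-zero eigenvalues of `ψ₋ψ₊` with an eigenvector in `E₊ = Hom(Gm) n`), such that for all `a, b ≠ 0` the degree-`n`
rank is the GENERIC value `C(2n,n)(2+ρ) − 2ρ` EXACTLY when `ab ∉ Λ(q)` — the printed SHAPE (γ)(δ) of W-PURITY(ρ) (FORMULA-N PART B §L.5); the identification
`Λ(q) = Spec≠0((−1)ⁿ(H_n(q)Ω_n)²)` with its drop multiplicities stays DERIVED (×2) + exact numerics, NOT in the kernel.
-/

open Module Set Set.powersetCard Summit.Ventures.HSemireg.Wedge.Hankel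

namespace Summit.Ventures.HSemireg.Wedge.Weil

variable (K : Type*) [Field K]

/-! ## PART S4 (th-7 g7, 2026-08-23) — THE EXCEPTIONAL LOCUS `{ab ∈ Λ(q)}` (FORMULA-N PART B §L.5 W-PURITY(ρ), shape (γ)(δ))
`Λ(q) :=` the non-zero eigenvalues of `ψ₋ψ₊` having an eigenvector in `E₊` — a finite set with `|Λ(q)| ≤ ρ`, depending on `q`
only; for all `a ≠ 0`, `b ≠ 0`: **rank(∧v ∣ HTⁿ) = C(2n,n)(2+ρ) − 2ρ ⟺ ab ∉ Λ(q)** (`weilPurity_locus`). This is the printed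
shape of W-PURITY(ρ) («the rank is the generic value exactly off ≤ ρ hyperbolas ab = λ»); the identification
`Λ(q) = Spec≠0((−1)ⁿ(H_n(q)Ω_n)²)` stays derived. -/

section Locus

variable {n : ℕ}

/-- the Schur operator depends on the product `ab` only: `schurOp a b = schurOp 1 (a·b)`. -/
lemma schurOp_eq_one (q : ℕ → K) (a b : K) : schurOp K n q a b = schurOp K n q 1 (a * b) := by
  rw [schurOp, schurOp, one_mul]

/-- rank equation ⟺ trivial Schur kernel (from `weilPurity_schur`). -/
lemma rank_eq_iff_ker_bot (hn : 1 ≤ n) (q : ℕ → K) {a : K} (ha : a ≠ 0) (b : K) :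
    Module.finrank K (LinearMap.range (wedge K (n + n) n (vW K (n + n) n q a b))) +
          2 * (hankel1 K (n + n) n q).rank =
        (n + n).choose n * (hankel1 K (n + n) n q).rank + ((n + n).choose n + (n + n).choose n) ↔
      Hom K (In (n + n)) (Gm (n + n) n) n ⊓ LinearMap.ker (schurOp K n q a b) = ⊥ := by
  have h := weilPurity_schur K hn q ha b
  rw [← Submodule.finrank_eq_zero (R := K) (M := HT K (In (n + n)))]
  omega

/-- **THE EXCEPTIONAL LOCUS (Weil type (n,n), m = n ≥ 1; every q, every field).** There is a finite set `Λ ⊆ K ∖ {0}`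
with `|Λ| ≤ ρ = rank H_n(q)` (depending on `q` only) such that for all `a ≠ 0`, `b ≠ 0`:
`rank(∧v ∣ HTⁿ) = C(2n,n)(2+ρ) − 2ρ` (additively `finrank range + 2ρ = C(2n,n)ρ + 2C(2n,n)`) **iff** `ab ∉ Λ`. -/
theorem weilPurity_locus (hn : 1 ≤ n) (q : ℕ → K) :
    ∃ Λ : Finset K, (0 : K) ∉ Λ ∧ Λ.card ≤ (hankel1 K (n + n) n q).rank ∧
      ∀ a b : K, a ≠ 0 → b ≠ 0 →
        (Module.finrank K (LinearMap.range (wedge K (n + n) n (vW K (n + n) n q a b))) +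
              2 * (hankel1 K (n + n) n q).rank =
            (n + n).choose n * (hankel1 K (n + n) n q).rank + ((n + n).choose n + (n + n).choose n) ↔
          a * b ∉ Λ) := by
  classical
  set T : Module.End K (HT K (In (n + n))) := psiM K n q ∘ₗ psiP K n q with hT
  set Λ : Finset K := (Finset.univ.image (fun μ : T.Eigenvalues => (μ : K))).filter
    (fun c => c ≠ 0 ∧ Hom K (In (n + n)) (Gm (n + n) n) n ⊓ LinearMap.ker (schurOp K n q 1 c) ≠ ⊥) with hΛ
  refine ⟨Λ, fun h => (Finset.mem_filter.mp h).2.1 rfl, ?_, ?_⟩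
  · exact card_exceptional_le K q one_ne_zero Λ (fun h => (Finset.mem_filter.mp h).2.1 rfl)
      (fun c hc => (Finset.mem_filter.mp hc).2.2)
  · intro a b ha hb
    rw [rank_eq_iff_ker_bot K hn q ha b, schurOp_eq_one K q a b]
    constructor
    · intro hbot hmem
      exact (Finset.mem_filter.mp hmem).2.2 hbot
    · intro hnot
      by_contra hne
      apply hnot
      refine Finset.mem_filter.mpr ⟨?_, mul_ne_zero ha hb, hne⟩
      obtain ⟨θ, hθ, hθ0⟩ := (Submodule.ne_bot_iff _).mp hne
      have hev : T.HasEigenvalue (a * b) := by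
        refine Module.End.hasEigenvalue_of_hasEigenvector (x := θ)
          (Module.End.hasEigenvector_iff.mpr ⟨?_, hθ0⟩)
        rw [Module.End.mem_eigenspace_iff, hT, LinearMap.comp_apply]
        have := (mem_ker_schurOp_iff K q 1 (a * b) θ).mp (Submodule.mem_inf.mp hθ).2
        rwa [one_mul] at this
      exact Finset.mem_image.mpr ⟨⟨a * b, hev⟩, Finset.mem_univ _, rfl⟩

end Locus

end Summit.Ventures.HSemireg.Wedge.Weil
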